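import Mathlib
import HarnessLib
import HarnessLib.Audit
import Summits.AtomisticToContinuum.Statement
import Literature.MathematicalPhysics.StatisticalMechanics.LennardJonesClusters
import Literature.MathematicalPhysics.StatisticalMechanics.BarlowStacking
import Summits.AtomisticToContinuum.Crystallization.Theorems.ExcessDecayLiouvilleCrysEnergyLimit
import Summits.AtomisticToContinuum.Crystallization.Theorems.PalmUnimodularRigidityCrysPeriodicBddBelow
import Summits.AtomisticToContinuum.Crystallization.Theorems.ThreeConeCertificateDefectVanishCrystallizes
import Summits.AtomisticToContinuum.Crystallization.Theorems.PricedLinkCensusCrysEnergyUpper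
import HarnessLib.Audit.Status.Attr

/-!
Route: HcpDefectCounting

# Route HcpDefectCounting — count defects, not surfaces — a radius-4 coercivity inequality around
hcp, conditional on the finite bulk floor, plus potential-free chart gluing decides both conjuncts

It suffices to show X = K_E ∧ K_C ∧ G (card one-grain-sbv-window, its P1 / P2–P4 split made exact
and REPAIRED after the
refutation of OneGrainGluing, stmt-3506). K_E = HcpBulkFloor: for some relaxed hcp stacking hcp(a,h)
in the box of stmt-3061
(47/50 ≤ a ≤ 1, 39/50·a ≤ h ≤ 17/20·a; `hcpPeriodicConfiguration`), N·e_LJ(hcp a h) ≤ 𝓔_LJ(x) for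
EVERY finite configuration x of
N distinct points — energetic crystallization in its sharp finite form (no limits). K_C =
HcpDefectCoercivity: for every such (a,h)
satisfying that floor, every separation δ and tolerance θ there is κ > 0 with N·e(hcp a h) +
κ·#Bad(4,θ) ≤ 𝓔(x) for every δ-separated
x, where particle i is Bad(ρ,η) unless some linear isometry A matches, both ways within η, the
particles in B_ρ(x_i) with
x_i + A(hcp points of norm ≤ ρ) (the matching predicate of BulkDefectVanish stmt-0751, at the FIXED
radius 4). G = HcpChartGluing
(potential-free): for δ-separated x, #Bad(R,ε) ≤ M(a,h,δ,R,ε)·#Bad(4,θ(a,h,δ,R,ε)). One physics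
inequality at one radius, one
finite energy inequality, one geometric lemma; everything else is shared bookkeeping (0629, 0714,
0751 → 0752, 3061, 0626).
Lean: `HcpBulkFloor ∧ HcpDefectCoercivity ∧ HcpChartGluing`

## Assembly
Pure logic, certified sorry-free in the planner's Sketch.lean / glue.lean (axioms propext,
Classical.choice, Quot.sound): FloorGivesMinimiser applied to (HcpBulkFloor, 0629, 0714) yields the
box point (a,h) with IsLeast e(hcp a h) and E(N)/N → ⨅ = e(hcp a h) (IsLeast.csInf_eq), i.e.
HasPeriodicGroundStateEnergy lennardJones 3; DefectGlue applied to the three cruxes and 0629/0714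
yields BulkDefectVanish, and DefectVanishCrystallizes with the proved
LennardJonesMinimalDistance_holds yields IsCrystallizing lennardJones 3; the pair is
`_root_.Crystallization` by `abbrev`. The deciding theorem `closes` takes exactly the eight items
HcpDefectCoercivity, HcpBulkFloor, HcpChartGluing, CrysEnergyUpper, CrysPeriodicBddBelow,
FloorGivesMinimiser, DefectGlue, DefectVanishCrystallizes and concludes `_root_.Crystallization` by
name.

Rationale: WHY THIS LINE. Blanc–Lewin's (16) (BlancLewin2015 §2.1) needs, per large N, only that MOST particles
carry a matched window, and a window count
comes from a finite-N inequality of Theil's shape — energy ≥ N·e* + κ·#defects (Theil2006 in d = 2;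
FlatleyTheil2015 in d = 3 with a
three-body term) — read against the trial bound limsup E(N)/N ≤ e* (stmt-0629): κ·#Bad ≤ E(N) − N·e*
= o(N). Two observations make the
card's line exact and thin. (i) Radius monotonicity: coercivity at radius R₁' implies it at every R₁
≤ R₁', so "coercivity at all
radii" (the retired OneGrainWindow's LjDefectCoercivity) silently contains the gluing step and makes
any gluing lemma redundant; the
honest split is ONE fixed radius (4, in units of the LJ equilibrium distance) for the physics plus a
potential-free propagation
lemma, which forces the template to be NAMED — relaxed hcp, the numerically selected LJ stacking
(Stillinger2001,
SchwerdtfegerBurrowsSmits2021, PartayOrtnerCsanyi2017), already the shared energetic target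
stmt-3061 of three open routes.
(ii) Every coercivity statement is measured against the unknown bulk constant, so the energetic
identification is split off as
the finite floor K_E (equivalent, modulo the provable glue items, to 3061 ∧ 0626) and K_C is stated
CONDITIONALLY on it: provers of
K_C may assume hcp(a,h) realises the bulk energy exactly. Imported areas: discrete-to-continuum
variational analysis (the
defect-counting format of Theil2006 / FriedrichKreutzSchmidt2021 / KreutzZiereis2026, of which only
the potential-independent
counting half is kept — no SBV, no cell energies), mathematical crystallography (cluster rigidity of
a vertex-transitive crystal:
the hcp first shell has symmetry group D3h = the site group, DolbilinLagariasSenechal1998,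
DolbilinEtAl2021, HalesDSP2012 §1.3).
Versus the negatives index: G is the separated, counting form of the refuted stmt-3506 (witness:
particles piled on one site),
and no item infers contact graphs from soft kissing (stmt-4146).

RANKED CRUXES. #2 HcpDefectCoercivity (crux) — DEFECT-COUNTING COERCIVITY AT RADIUS 4 AROUND RELAXED
HCP, CONDITIONAL ON THE BULK FLOOR (card P1). For all a, h ≠ 0 in the box 47/50 ≤ a ≤ 1, 39/50·a ≤ h
≤ 17/20·a: IF N·e_LJ(hcp a h) ≤ 𝓔_LJ(x) for every finite injective x (the floor of HcpBulkFloor, so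
only the LJ-optimal (a,h) is concerned), THEN for every δ > 0 and θ > 0 there is κ > 0 such that
every δ-separated configuration x of N points satisfies N·e_LJ(hcp a h) + κ·#{i : ¬Good(4,θ,i)} ≤
𝓔_LJ(x), where Good(ρ,η,i) means: some linear isometry A makes every hcp site p with ‖p‖ ≤ ρ have a
particle within η of x_i + A p and every particle within ρ of x_i lie within η of x_i + A p for some
hcp site p (0 is an hcp site; hcp is vertex-transitive, so origin-based charts lose nothing). Prices
vacuum-adjacent, strained (strain > θ/4), grain-boundary, stacking-faulted, vacancy-adjacent and
amorphous particles uniformly; contains strict stacking selection at the level of fault energies.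
The summed form is gauge-free: any transfer/gauge is a proof device. [deps: HcpBulkFloor]
[difficulty: open-problem] (why it might fail: Only the optimal hcp matters (floor hypothesis); dies
if it has a zero-cost defect: degenerate stacking (fault cost ≈6e-5/column rests on uncertified J₂
<0, items 0737/0670), a soft elastic/inner mode, or polytetrahedral order with excess/#Bad → 0; no
3-D Theil bound is known.) [Theil2006, FlatleyTheil2015, BlancLewin2015, PartayOrtnerCsanyi2017,
LoachAckland2017, Literature.Barriers.AtomisticToContinuum.TetrahedralFrustration,
Literature.Barriers.AtomisticToContinuum.KissingTwelveDegeneracy]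
#3 HcpBulkFloor (crux) — THE FINITE BULK FLOOR AT HCP (energetic crystallization, sharp finite form,
minimiser named). There are a, h ≠ 0 in the box 47/50 ≤ a ≤ 1, 39/50·a ≤ h ≤ 17/20·a such that
N·e_LJ(hcp a h) ≤ 𝓔_LJ(x) for every N and every injective x : Fin N → ℝ³: no finite cluster beats
the relaxed hcp crystal per particle. Equivalent (items FloorGivesMinimiser / MinimiserGivesFloor,
both provable now) to HcpPeriodicMinimiser ∧ CrysEnergyLimit (stmt-3061 ∧ stmt-0626): "⇐" by LJ
superadditivity E(kN) < k·E(N) (k far-apart copies of a ground state; cross terms V_LJ(r) ≤ 0 for r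
≥ 1) and E(kN)/(kN) → e; "⇒" with 0629/0714. It is the hypothesis under which HcpDefectCoercivity is
claimed and the only energetic input of the route. [difficulty: open-problem] (why it might fail:
False iff relaxed hcp is not the bulk LJ minimiser with E(N)/N → e(hcp): fcc loses by only 7.5e-5
per particle (lattice sums A₆²/2A₁₂, not certified in Lean), a longer polytype, aperiodic stacking
or non-close-packed phase could win; and liminf E(N)/N ≥ min_Q e(Q) is itself open in d = 3.)
[Stillinger2001, SchwerdtfegerBurrowsSmits2021, PartayOrtnerCsanyi2017, LoachAckland2017,
BlancLewin2015, BeterminSamajTravenec2022,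
Literature.Barriers.AtomisticToContinuum.Hubbard1978_mostHomogeneous]
#4 HcpChartGluing (crux) — CHART GLUING FOR HCP, COUNTING FORM (card P2–P4; potential-free; the
separated repair of refuted stmt-3506). For all a, h ≠ 0 in the box and all δ, R, ε > 0 there are θ
> 0 and M ∈ ℕ such that every δ-separated finite configuration satisfies #{i : ¬Good(R,ε,i)} ≤ M·#{i
: ¬Good(4,θ,i)} (Good as in HcpDefectCoercivity). Proof idea: a particle with no Bad(4,θ) particle
within R + 8 is Good(R,ε): extend its chart F_i = x_i + A(·) shell by shell — a particle j already
matched at distance ≤ ρ − 1.15 carries its whole first shell (12 sites at distance ≤ 1.03a, next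
shell ≥ 1.39a on the box) inside the matched ball, both charts match those 13 particles, and an
isometry mapping a centred hcp shell (θ+ε')-close onto a centred hcp shell is o(1)-close to a
symmetry of hcp (Sym(shell) = D3h = site group; hcp vertex-transitive and centrosymmetric, improper
A allowed), so F_j ≈ F_i ∘ g and the matched radius grows by ≥ 1 per step with tolerance loss
controlled by θ; δ-separation bounds the particles within R + 8 of a Bad one by M − 1. Finite
clusters are consistent: every finite x has ≥ 1 Bad(4,θ) particle for θ < a/2. [difficulty: L] (why
it might fail: Refuted once on typing (3506: no separation); remaining traps: origin-based charts
need vertex-transitivity and Sym(first shell) = site group D3h on the whole (a,h) box, chaining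
needs covering radius 0.72 < slack at radius 4, improper A must be symmetries (hcp
centrosymmetric).) [DolbilinLagariasSenechal1998, Dolbilin2016, DolbilinEtAl2021, HalesDSP2012,
ConwaySloane1999, Literature.Barriers.AtomisticToContinuum.HcpNotBravais]
#9 CrysEnergyUpper (support) — shared item stmt-0629: trial-state upper bound limsup E(N)/N ≤ ⨅ over
periodic Q of e_LJ(Q) (finite blocks of Q, boundary O(N^{2/3}), r⁻⁶ tail summable in d = 3).
[difficulty: M] [BlancLewin2015, Theil2006]
#9 CrysPeriodicBddBelow (support) — shared item stmt-0714: the LJ energy per particle of periodic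
configurations of ℝ³ is bounded below (stability), so ⨅_Q e(Q) is a genuine infimum (ciInf_le).
[difficulty: M] [BlancLewin2015]
#9 HcpPeriodicMinimiser (support) — shared item stmt-3061 (target of PoissonBesselStacking /
LuttingerTiszaRegistry, support of ChessboardParticlePlanes): some relaxed hcp(a,h) in the box is a
least element of e_LJ over periodic configurations. Here a COROLLARY of HcpBulkFloor
(FloorGivesMinimiser) and, with CrysEnergyLimit, a sufficient condition for it
(MinimiserGivesFloor). [difficulty: open-problem] [Stillinger2001, PartayOrtnerCsanyi2017,
BeterminSamajTravenec2022, BlancLewin2015]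
#9 CrysEnergyLimit (support) — shared item stmt-0626: E(N)/N → ⨅ over periodic Q of e_LJ(Q). Here
derived from HcpBulkFloor + 0629 + 0714 (FloorGivesMinimiser); conversely an input of
MinimiserGivesFloor. [difficulty: open-problem] [BlancLewin2015]
#9 BulkDefectVanish (support) — shared item stmt-0751 (crux of PoissonBesselStacking /
LuttingerTiszaRegistry): one periodic P such that for every R, ε, along every sequence of LJ ground
states all but o(N) particles carry an origin-based two-way ε-matched window of radius R onto x_i +
A(P.points). Here the OUTPUT of DefectGlue with P = hcpPeriodicConfiguration (vertex-transitive, 0 ∈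
points, so the refuters' typing caveat on 0751 is met). [difficulty: open-problem] [BlancLewin2015,
Hales2012, PartayOrtnerCsanyi2017]
#9 DefectVanishCrystallizes (support) — shared item stmt-0752: BulkDefectVanish →
LennardJonesMinimalDistance → IsCrystallizing lennardJones 3 (diagonal over (R,ε) = (k,1/k),
O(3)-compactness of the isometries, PeriodicConfiguration.tendsto_sum_of_eventually_near' with the
minimal distance; isometryImage of P is periodic, m ≡ 1). The Literature fact is discharged in
`closes` by the proved LennardJonesMinimalDistance_holds. [difficulty: M] [BlancLewin2015, Xue1997]
#10 FloorGivesMinimiser (support) — (glue, energetic half) HcpBulkFloor → CrysEnergyUpper →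
CrysPeriodicBddBelow → HcpPeriodicMinimiser ∧ CrysEnergyLimit. Proof: the floor gives N·e ≤ E(N)
(le_ciInf over injective configurations, nonempty_injective_config) hence e ≤ E(N)/N for N ≥ 1; with
limsup E(N)/N ≤ ⨅_Q e(Q) ≤ e(hcp a h) (ciInf_le, 0714) the bounded sequence E(N)/N (−B ≤ · ≤ 0)
converges to e = ⨅, and e ≤ liminf ≤ ⨅ ≤ e(Q) for all Q gives IsLeast with the same (a,h) and box.
[difficulty: provable-now] [BlancLewin2015]
#10 MinimiserGivesFloor (support) — (glue, converse; lets a proof of 3061 ∧ 0626 elsewhere close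
HcpBulkFloor) HcpPeriodicMinimiser → CrysEnergyLimit → HcpBulkFloor. Proof: IsLeast.csInf_eq turns
0626 into E(N)/N → e(hcp a h); LJ superadditivity E(kN) ≤ k·𝓔(x) for every injective x of N ≥ 1
points (k translates of x pairwise ≥ diam + 1 apart: cross distances ≥ 1 so cross terms ≤ 0 by
lennardJones_nonpos; interactionEnergy_append) gives E(kN)/(kN) ≤ 𝓔(x)/N, and k → ∞ along the
subsequence kN gives e ≤ 𝓔(x)/N; N = 0 is 0 ≤ 0. [difficulty: provable-now] [BlancLewin2015]
#10 DefectGlue (support) — (glue, positional half; Chebyshev counting) HcpDefectCoercivity →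
HcpBulkFloor → HcpChartGluing → CrysEnergyUpper → CrysPeriodicBddBelow → BulkDefectVanish. Proof:
take (a,h, floor) from HcpBulkFloor and P := hcpPeriodicConfiguration ha hh; fix R, ε and a sequence
of ground states x^N; δ from the PROVED LennardJonesMinimalDistance_holds; (θ, M) from
HcpChartGluing; κ from HcpDefectCoercivity(δ, θ). Then #Bad(R,ε) ≤ M·#Bad(4,θ) ≤ (M/κ)(E(N) − N·e)
since 𝓔(x^N) = E(N), and 0 ≤ E(N)/N − e → 0 (floor below; limsup ≤ ⨅ ≤ e above), so #Bad(R,ε)/N → 0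
— literally the predicate of stmt-0751. [difficulty: provable-now] [BlancLewin2015, Theil2006]

TWO-LAYER PLAN. Foreseen glued splits (k ≤ 3, depth 1; nothing filed now). HcpDefectCoercivity ⇐
BarlowTier → StackingTier → HcpDefectCoercivity:
BarlowTier prices κ₁ per particle whose radius-2 environment is θ-far from EVERY Barlow stacking
(`barlowStacking a h s`) —
the local close-packing inequality (Flyspeck-type certificate with finite-range transfers; cards
equality-free-certificates-
phonon-near-field, frustration-range-lp-hierarchy, two-shell-rigidity-certificate); StackingTier
prices κ₂ per Barlow-matched
particle in a non-h layer (Hägg domination 0737 + certified interlayer couplings 0670, |J₂| ≈ 7.3e-5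
dominating Σ_{k≥3} k|J_k|);
glue Bad_hcp(4,θ) ⊆ Bad_Barlow(2,θ') ∪ (non-h layers) ∪ (their radius-4 neighbours). HcpChartGluing
⇐ HcpShellRigidity (an
isometry mapping a centred first shell of hcp(a,h) η-close onto one is o(1)-close to a symmetry;
compactness of O(3) × cell) →
ChartExtension (the induction) → HcpChartGluing. HcpBulkFloor ⇐ MinimiserGivesFloor with 3061
(PoissonBesselStacking's
decomposition) and 0626, or directly from a proof of HcpDefectCoercivity-type inequalities for ALL
configurations.

KILL CRITERIA. ¬HcpBulkFloor by ONE certified finite configuration x with 𝓔_LJ(x) < N·e_LJ(hcp a h)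
for all box (a,h) — e.g. a large
fcc / dhcp / 9R block if a certified lattice-sum comparison ever puts another stacking below hcp, or
an aperiodic optimal
stacking (then 0668 of RefuteCrystalPeriodicMin fires and conjunct (i) itself dies) — closes the
route `refuted:HcpBulkFloor`;
if the witness is another PERIODIC Barlow stacking P', pivot: re-file the three cruxes with
`barlowPeriodicConfiguration` of P'
(same mechanism, new decls; G needs P' vertex-transitive or motif-based charts). ¬HcpChartGluing can
only exploit typing
(it is a geometric lemma): restate as a new item, as done here after 3506. ¬HcpDefectCoercivity
under the floor hypothesis
(a zero-cost defect family of the optimal hcp) kills the mechanism: close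
`refuted:HcpDefectCoercivity`. BulkDefectVanish (0751)
or PeriodicWindows (3240) proved elsewhere moot the positional half but not the route (K_E still
decides (i)); Crystallization
refuted via 0668 moots everything.

NOT DECOMPOSED YET. The constants κ(δ,θ) (expected min{c·θ²/16, g_fault/10} with g_fault ≈ 6e-5) and
the transfer/gauge FORMAT of a proof of
HcpDefectCoercivity (tier split above); the certified identification of (a*, h*) (a* =
(A₁₂/A₆)^{1/6} ≈ 0.9712, h*/a* ≈ 0.8165)
inside HcpBulkFloor; the explicit θ(R,ε), M(δ,R) of HcpChartGluing and its shell-rigidity lemma; the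
card's SBV / mesoscale
strengthening (grains of ≍ N^{1/3} atoms via piecewise rigidity, ChambolleGiacominiPonsiglione2007,
FriedrichKreutzSchmidt2021,
KreutzZiereis2026) — true-looking, not needed for (16), not typable without SBV in Mathlib; an
fcc/polytype fallback template.

CHEAPEST FALSIFIER. (i) Certified interval lattice sums: min_{a,h} e_LJ(hcp a h) against min
e_LJ(fcc), e_LJ(dhcp), e_LJ(9R) (Stillinger2001:
−A₆²/(2A₁₂) = −8.6111 hcp vs −8.6102 fcc in units 12·V_LJ; SchwerdtfegerBurrowsSmits2021); any
competitor ≤ hcp with margin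
beyond the O(N^{2/3}) surface term of an explicit block kills HcpBulkFloor. (ii) A kit tabulation a
refuter can run first: for the
putative LJ global minima N ≤ 1610 (Cambridge Cluster Database) check E(N) > N·e(hcp*) (predicted
margin ≥ 17 % at N = 1000:
−7.13 vs −8.61 per particle) and, for fcc/hcp/decahedral/icosahedral motifs up to N ≈ 10⁴, tabulate
(𝓔 − N·e(hcp*))/#Bad(4, 0.1):
HcpDefectCoercivity predicts a positive floor; stress cases are large fcc-twinned decahedra (#Bad ≍
twin area). (iii) For
HcpChartGluing: enumerate isometries mapping the 13-point centred shell of hcp(a,h) within 0.05 onto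
itself at the box corners
(a,h) ∈ {0.94,1}×{0.78a,0.85a}: exactly 12 expected. Not run here (compute-free hub; no kit job
submitted at open).

NUMBERS. V_LJ = r⁻¹²/12 − r⁻⁶/6, min −1/12 at r = 1. Lattice sums (Stillinger2001): fcc A₁₂ =
12.13188, A₆ = 14.45392; hcp A₁₂ = 12.13229,
A₆ = 14.45489; optimal e = −A₆²/(2A₁₂): hcp −8.6111, fcc −8.6102 (×1/12 in tree units: −0.71759 vs
−0.71752, gap 7.5e-5 per
particle); a* = (A₁₂/A₆)^{1/6} = 0.9712 ∈ [0.94, 1], h* ≈ 0.8165·a* = 0.793 ∈ [0.78a*, 0.85a*].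
Cluster minima E(N)/N (units 12·V):
−3.41 (13), −5.08 (55), −5.96 (147), −7.13 (1000) — all above −8.61 (HcpBulkFloor margin). hcp(a,h)
first shell on the box: 6
sites at a, 6 at √(a²/3 + h²) ∈ [0.968a, 1.027a]; next sites ≥ 1.39a; deepest hole (octahedral) at
√(a²/3 + h²/4) ≤ 0.72a
(chaining slack at radius 4 ≥ 1). Site symmetry of hcp (Wyckoff 2c of P6₃/mmc) = 6̄m2 = D3h, order
12 = |Sym(anticuboctahedron)|.
Uniform minimal distance δ of LJ ground states: LennardJonesMinimalDistance_holds (proved). Fault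
cost per column ≈ 6.4e-5,
J₂ ≈ −7.3e-5 (route-internal numerics behind 0670/0737, uncertified). Items at open: 13 (3 cruxes, 9
support, 1 assembly).

DEFINITION REQUESTS. None: hcpPeriodicConfiguration, PeriodicConfiguration.points/energyPerParticle,
interactionEnergy, groundStateEnergy,
IsGroundState, IsCrystallizing, LennardJonesMinimalDistance all exist (BarlowStacking.lean,
Crystallization.lean,
LennardJonesClusters.lean); the matching predicate is inlined as `let Good := …` exactly in the
shape of stmt-0751.

Novelty: Searches (2026-08-15): `lit frontier AtomisticToContinuum --since 2020` (30 rows; on point: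
arXiv:2604.19239 Kreutz–Ziereis,
doi:10.5802/mrr.25 planar crystallization for arbitrary norms); `lit galaxy search "proof of
crystallization in two dimensions"
--star all` (8: panama Presutti's Scaling Limits, Alicandro–Braides–Cicalese–Solci *Discrete
Variational Problems with Interfaces*;
pdf arXiv:1601.05968 Alicandro–Lazzaroni–Palombaro, CMP 10.1007/s00220-021-04216-6, EMS 2021 — all d
= 2 or rigid/short-range);
`lit galaxy search "local criterion for regularity of a system of points" --star all` (7: Handbook
of Convex Geometry, Intuitive
Geometry (Böröczky–Fejes Tóth), Lord–Mackay–Ranganathan — the Delone–Dolbilin local theory); galaxy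
"polytypism in the ground
state structure of the Lennard-Jones" / "face-centered cubic crystallization of atomistic
configurations" (0, not held);
`lit search` local/remote tiers unavailable today (searchd rc 75); plus the card audit
(refuter-3/14: crossref ×3, zbMATH, KZ read)
and the retired OneGrainWindow header searches (Dolbilin2016, DolbilinEtAl2021,
doi:10.1134/s199508022560551x, arXiv:1707.07664,
arXiv:2004.06820). Nearest prior art found: Theil2006 (d = 2 defect-counting energy bound),
FlatleyTheil2015 (d = 3, three-body
term, energy only), FriedrichKreutzSchmidt2021 and KreutzZiereis2026 (arXiv:2604.19239: polycrystal
compactness from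
surface-scaling excess with RIGID cell energies, hcp included as a multi-lattice),
DolbilinLagariasSenech  [refs: 10.5802/mrr.25, 10.1007/s00220-021-04216-6, 10.1134/s199508022560551x, 2604.19239, 1601.05968, 1707.07664, 2004.06820, doi:10.5802/mrr.25, doi:10.1134/s199508022560551x, Dolbilin2016, DolbilinEtAl2021, Theil2006, FlatleyTheil2015, FriedrichKreutzSchmidt2021, KreutzZiereis2026, DolbilinLagariasSenechal1998, BlancLewin2015]

Barriers (technique_class: defect-counting coercivity; chart gluing): - technique_class: defect-counting coercivity; chart gluing
- Literature.Barriers.AtomisticToContinuum.IcosahedralClusters: evaded — no finite-N exactness or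
crystal-fragment ansatz; LJ₁₃-type and amorphous particles are simply Bad and pay (excess ≈ +0.43
per particle over e* for the icosahedron), consistent with HcpDefectCoercivity; it only forbids a
first-shell POINTWISE proof of K_C, declared in its why-might-fail.
- Literature.Barriers.AtomisticToContinuum.StickySphereClusters: evaded for the same reason —
nothing is transplanted from the sticky limit except the counting format.
- Literature.Barriers.AtomisticToContinuum.TetrahedralFrustration: applies to any proof of
HcpDefectCoercivity by pure single-cell Voronoi/Delaunay bounds; the bet (two-layer plan) is a
hybrid certificate with transfers of range ≥ 2 shells plus the tail tier; HcpBulkFloor and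
HcpChartGluing are untouched.
- Literature.Barriers.AtomisticToContinuum.KissingTwelveDegeneracy: respected — contacts never
select the stacking here: radius 4 > 2h sees second-layer registry and the fault price inside K_C
comes from the r⁻⁶ tail (Hägg domination 0737), not from kissing; HcpChartGluing is stated for hcp
only, where an all-Good region IS single-stacked.
- Literature.Barriers.AtomisticToContinuum.ShortRangeStackingBlindness: same point — V_LJ is never
truncated; a truncated potential would make K_C false (equal-energy polytypes all-Bad), which is the
correct behaviour.
- Literature.Barriers.AtomisticToContinuum

History (route lifecycle, newest last):
- 2026-08-23T14:30:12Z · DORMANT — reconciler: no traction for 6.1 d (last activity statement-grounded at 2026-08-17T11:42:18Z); parked, not closed — `ledger route dormant route-AtomisticToContin (operator:999:631235)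
- 2026-08-31T09:27:56Z · REACTIVATED (open) — reconciler: reactivated — activity statement-checked at 2026-08-31T08:34:34Z after parking at 2026-08-23T14:30:12Z (operator:999:2625562)

sub-problem: Crystallization · status: open · opened planner-plancard-AtomisticToContinuum-Crystal-f8ad38a7-g2-0 2026-08-15T19:08:49Z · rev 0 · ledger route-AtomisticToContinuum-HcpDefectCounting
GENERATED by the gate from the ledger (D-0016/17). Provers cite these decls: `theorem foo : Summit.AtomisticToContinuum.Crystallization.Theses.HcpDefectCounting.<Decl> := …` in Summits/AtomisticToContinuum/Crystallization/Theorems/<Name>.lean.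
-/

namespace Summit.AtomisticToContinuum.Crystallization.Theses.HcpDefectCounting

open scoped BigOperators Topology Manifold Classical MeasureTheory ProbabilityTheory Matrix InnerProductSpace ComplexConjugate ContinuousMap
open Filter Set Function TopologicalSpace MeasureTheory

attribute [summit_statement] _root_.Crystallization

/-- item stmt-AtomisticToContinuum-14476 · crux · rank 2 · open · by planner
why it might fail: Only the optimal hcp matters (floor hypothesis); dies if it has a zero-cost defect: degenerate stacking (fault cost ≈6e-5/column rests on uncertified J₂ <0, items 0737/0670), a soft elastic/inner mode, or polytetrahedral order with excess/#Bad → 0; no 3-D Theil bound is known.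
sources: Theil2006, FlatleyTheil2015, BlancLewin2015, PartayOrtnerCsanyi2017, LoachAckland2017, Literature.Barriers.AtomisticToContinuum.TetrahedralFrustration
[crux] DEFECT-COUNTING COERCIVITY AT RADIUS 4 AROUND RELAXED HCP, CONDITIONAL ON THE BULK FLOOR
(card P1). For all a, h ≠ 0 in the box 47/50 ≤ a ≤ 1, 39/50·a ≤ h ≤ 17/20·a: IF N·e_LJ(hcp a h) ≤
𝓔_LJ(x) for every finite injective x (the floor of HcpBulkFloor, so only the LJ-optimal (a,h) is
concerned), THEN for every δ > 0 and θ > 0 there is κ > 0 such that every δ-separated configuration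
x of N points satisfies N·e_LJ(hcp a h) + κ·#{i : ¬Good(4,θ,i)} ≤ 𝓔_LJ(x), where Good(ρ,η,i) means:
some linear isometry A makes every hcp site p with ‖p‖ ≤ ρ have a particle within η of x_i + A p and
every particle within ρ of x_i lie within η of x_i + A p for some hcp site p (0 is an hcp site; hcp
is vertex-transitive, so origin-based charts lose nothing). Prices vacuum-adjacent, strained (strain
> θ/4), grain-boundary, stacking-faulted, vacancy-adjacent and amorphous particles uniformly;
contains strict stacking selection at the level of fault energies. The summed form is gauge-free:
any transfer/gauge is a proof device. [deps: HcpBulkFloor] [difficulty: open-problem] -/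
@[route_item "route-AtomisticToContinuum-HcpDefectCounting", crux]
def HcpDefectCoercivity : Prop :=
  ∀ (a h : ℝ) (ha : a ≠ 0) (hh : h ≠ 0), 47 / 50 ≤ a → a ≤ 1 → 39 / 50 * a ≤ h → h ≤ 17 / 20 * a → (∀ (N : ℕ) (x : Fin N → EuclideanSpace ℝ (Fin 3)), Function.Injective x → (N : ℝ) * (Literature.MathematicalPhysics.StatisticalMechanics.hcpPeriodicConfiguration ha hh).energyPerParticle Literature.MathematicalPhysics.StatisticalMechanics.lennardJones ≤ Literature.MathematicalPhysics.StatisticalMechanics.interactionEnergy Literature.MathematicalPhysics.StatisticalMechanics.lennardJones x) → ∀ δ θ : ℝ, 0 < δ → 0 < θ → ∃ κ : ℝ, 0 < κ ∧ ∀ (N : ℕ) (x : Fin N → EuclideanSpace ℝ (Fin 3)), (∀ i j : Fin N, i ≠ j → δ ≤ dist (x i) (x j)) → let Good : ℝ → ℝ → Fin N → Prop := fun ρ η i => ∃ A : EuclideanSpace ℝ (Fin 3) →ₗᵢ[ℝ] EuclideanSpace ℝ (Fin 3), (∀ p ∈ (Literature.MathematicalPhysics.StatisticalMechanics.hcpPeriodicConfiguration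 ha hh).points, ‖p‖ ≤ ρ → ∃ j : Fin N, dist (x j) (x i + A p) ≤ η) ∧ (∀ j : Fin N, dist (x j) (x i) ≤ ρ → ∃ p ∈ (Literature.MathematicalPhysics.StatisticalMechanics.hcpPeriodicConfiguration ha hh).points, dist (x j) (x i + A p) ≤ η); (N : ℝ) * (Literature.MathematicalPhysics.StatisticalMechanics.hcpPeriodicConfiguration ha hh).energyPerParticle Literature.MathematicalPhysics.StatisticalMechanics.lennardJones + κ * (Nat.card {i : Fin N // ¬ Good 4 θ i} : ℝ) ≤ Literature.MathematicalPhysics.StatisticalMechanics.interactionEnergy Literature.MathematicalPhysics.StatisticalMechanics.lennardJones x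

/-- item stmt-AtomisticToContinuum-14477 · crux · rank 3 · open · by planner
why it might fail: False iff relaxed hcp is not the bulk LJ minimiser with E(N)/N → e(hcp): fcc loses by only 7.5e-5 per particle (lattice sums A₆²/2A₁₂, not certified in Lean), a longer polytype, aperiodic stacking or non-close-packed phase could win; and liminf E(N)/N ≥ min_Q e(Q) is itself open in d = 3.
sources: Stillinger2001, SchwerdtfegerBurrowsSmits2021, PartayOrtnerCsanyi2017, LoachAckland2017, BlancLewin2015, BeterminSamajTravenec2022
[crux] THE FINITE BULK FLOOR AT HCP (energetic crystallization, sharp finite form, minimiser named).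
There are a, h ≠ 0 in the box 47/50 ≤ a ≤ 1, 39/50·a ≤ h ≤ 17/20·a such that N·e_LJ(hcp a h) ≤
𝓔_LJ(x) for every N and every injective x : Fin N → ℝ³: no finite cluster beats the relaxed hcp
crystal per particle. Equivalent (items FloorGivesMinimiser / MinimiserGivesFloor, both provable
now) to HcpPeriodicMinimiser ∧ CrysEnergyLimit (stmt-3061 ∧ stmt-0626): "⇐" by LJ superadditivity
E(kN) < k·E(N) (k far-apart copies of a ground state; cross terms V_LJ(r) ≤ 0 for r ≥ 1) and
E(kN)/(kN) → e; "⇒" with 0629/0714. It is the hypothesis under which HcpDefectCoercivity is claimed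
and the only energetic input of the route. [difficulty: open-problem] -/
@[route_item "route-AtomisticToContinuum-HcpDefectCounting", crux]
def HcpBulkFloor : Prop :=
  ∃ a h : ℝ, ∃ (ha : a ≠ 0) (hh : h ≠ 0), 47 / 50 ≤ a ∧ a ≤ 1 ∧ 39 / 50 * a ≤ h ∧ h ≤ 17 / 20 * a ∧ ∀ (N : ℕ) (x : Fin N → EuclideanSpace ℝ (Fin 3)), Function.Injective x → (N : ℝ) * (Literature.MathematicalPhysics.StatisticalMechanics.hcpPeriodicConfiguration ha hh).energyPerParticle Literature.MathematicalPhysics.StatisticalMechanics.lennardJones ≤ Literature.MathematicalPhysics.StatisticalMechanics.interactionEnergy Literature.MathematicalPhysics.StatisticalMechanics.lennardJones x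

/-- item stmt-AtomisticToContinuum-14478 · crux · rank 4 · open · by planner
why it might fail: Refuted once on typing (3506: no separation); remaining traps: origin-based charts need vertex-transitivity and Sym(first shell) = site group D3h on the whole (a,h) box, chaining needs covering radius 0.72 < slack at radius 4, improper A must be symmetries (hcp centrosymmetric).
sources: DolbilinLagariasSenechal1998, Dolbilin2016, DolbilinEtAl2021, HalesDSP2012, ConwaySloane1999, Literature.Barriers.AtomisticToContinuum.HcpNotBravais
[crux] CHART GLUING FOR HCP, COUNTING FORM (card P2–P4; potential-free; the separated repair of
refuted stmt-3506). For all a, h ≠ 0 in the box and all δ, R, ε > 0 there are θ > 0 and M ∈ ℕ such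
that every δ-separated finite configuration satisfies #{i : ¬Good(R,ε,i)} ≤ M·#{i : ¬Good(4,θ,i)}
(Good as in HcpDefectCoercivity). Proof idea: a particle with no Bad(4,θ) particle within R + 8 is
Good(R,ε): extend its chart F_i = x_i + A(·) shell by shell — a particle j already matched at
distance ≤ ρ − 1.15 carries its whole first shell (12 sites at distance ≤ 1.03a, next shell ≥ 1.39a
on the box) inside the matched ball, both charts match those 13 particles, and an isometry mapping a
centred hcp shell (θ+ε')-close onto a centred hcp shell is o(1)-close to a symmetry of hcp
(Sym(shell) = D3h = site group; hcp vertex-transitive and centrosymmetric, improper A allowed), so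
F_j ≈ F_i ∘ g and the matched radius grows by ≥ 1 per step with tolerance loss controlled by θ;
δ-separation bounds the particles within R + 8 of a Bad one by M − 1. Finite clusters are
consistent: every finite x has ≥ 1 Bad(4,θ) particle for θ < a/2. [difficulty: L] -/
@[route_item "route-AtomisticToContinuum-HcpDefectCounting", crux]
def HcpChartGluing : Prop :=
  ∀ (a h : ℝ) (ha : a ≠ 0) (hh : h ≠ 0), 47 / 50 ≤ a → a ≤ 1 → 39 / 50 * a ≤ h → h ≤ 17 / 20 * a → ∀ δ R ε : ℝ, 0 < δ → 0 < R → 0 < ε → ∃ θ : ℝ, 0 < θ ∧ ∃ M : ℕ, ∀ (N : ℕ) (x : Fin N → EuclideanSpace ℝ (Fin 3)), (∀ i j : Fin N, i ≠ j → δ ≤ dist (x i) (x j)) → let Good : ℝ → ℝ → Fin N → Prop := fun ρ η i => ∃ A : EuclideanSpace ℝ (Fin 3) →ₗᵢ[ℝ] EuclideanSpace ℝ (Fin 3), (∀ p ∈ (Literature.MathematicalPhysics.StatisticalMechanics.hcpPeriodicConfiguration ha hh).points, ‖p‖ ≤ ρ → ∃ j : Fin N, dist (x j) (x i + A p) ≤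 η) ∧ (∀ j : Fin N, dist (x j) (x i) ≤ ρ → ∃ p ∈ (Literature.MathematicalPhysics.StatisticalMechanics.hcpPeriodicConfiguration ha hh).points, dist (x j) (x i + A p) ≤ η); Nat.card {i : Fin N // ¬ Good R ε i} ≤ M * Nat.card {i : Fin N // ¬ Good 4 θ i}

/-- item stmt-AtomisticToContinuum-0626 · support · rank 9 · closed · proved by Summit.AtomisticToContinuum.Crystallization.Theorems.crysEnergyLimit_proof @ f456c3bab3f9 (prover) · by planner
sources: BlancLewin2015
Energetic crystallization: E(N)/N converges to the infimum over periodic (multi-lattice)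
configurations of the LJ energy per particle in d = 3. Lower bound liminf ≥ ⨅ is the content ((a)
local optimality + (d) + surface term O(N^{2/3})); upper bound is filed separately. -/
@[route_item "route-AtomisticToContinuum-HcpDefectCounting"]
def CrysEnergyLimit : Prop :=
  Filter.Tendsto (fun N : ℕ => Literature.MathematicalPhysics.StatisticalMechanics.groundStateEnergy Literature.MathematicalPhysics.StatisticalMechanics.lennardJones 3 N / N) Filter.atTop (nhds (⨅ Q : Literature.MathematicalPhysics.StatisticalMechanics.PeriodicConfiguration 3, Q.energyPerParticle Literature.MathematicalPhysics.StatisticalMechanics.lennardJones))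

/-- `CrysEnergyLimit` holds: proved by `Summit.AtomisticToContinuum.Crystallization.Theorems.crysEnergyLimit_proof` @ f456c3bab3f9. -/
theorem CrysEnergyLimit_holds : CrysEnergyLimit := _root_.Summit.AtomisticToContinuum.Crystallization.Theorems.crysEnergyLimit_proof

/-- item stmt-AtomisticToContinuum-0714 · support · rank 9 · closed · proved by Summit.AtomisticToContinuum.Crystallization.Theorems.crysPeriodicBddBelow_proof (prover) · by planner
sources: BlancLewin2015
The Lennard-Jones energy per particle of periodic configurations of ℝ³ (any full-rank lattice, any
finite motif) is bounded below (by −B, the stability constant: finite blocks of Q as N-point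
configurations, boundary O(N^{2/3}), r⁻⁶ tail summable in d = 3). Makes ⨅_Q e(Q) a genuine infimum
(ciInf_le usable) in 0626/0629 and in the periodisation lemma. -/
@[route_item "route-AtomisticToContinuum-HcpDefectCounting", crux]
def CrysPeriodicBddBelow : Prop :=
  BddBelow (Set.range fun Q : Literature.MathematicalPhysics.StatisticalMechanics.PeriodicConfiguration 3 => Q.energyPerParticle Literature.MathematicalPhysics.StatisticalMechanics.lennardJones)

/-- `CrysPeriodicBddBelow` holds: proved by `Summit.AtomisticToContinuum.Crystallization.Theorems.crysPeriodicBddBelow_proof`. -/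
theorem CrysPeriodicBddBelow_holds : CrysPeriodicBddBelow := _root_.Summit.AtomisticToContinuum.Crystallization.Theorems.crysPeriodicBddBelow_proof

/-- item stmt-AtomisticToContinuum-0751 · support · rank 9 · open · by planner
sources: BlancLewin2015, Hales2012, PartayOrtnerCsanyi2017
[crux] HINGE: there is ONE periodic configuration P (the LJ-optimal HCP-type stacking, 0 ∈ motif)
such that for every window radius R and tolerance ε, in every sequence of LJ ground states all but
o(N) particles i admit a linear isometry A with the particles in B_R(x_i) ε-matched both ways to x_i
+ A(P.points ∩ B_R). Follows from (K1) SoftTwelveCoordination + (K2) RobustFejesTothHales + (K3)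
stacking selection (Hägg domination 0716/0737 + certified J_k) with ≤ K fault planes per ground
state. Sources: Hales2012 Thm 1; HaggStacking.lean; PartayOrtnerCsanyi2017. -/
@[route_item "route-AtomisticToContinuum-HcpDefectCounting"]
def BulkDefectVanish : Prop :=
  ∃ P : Literature.MathematicalPhysics.StatisticalMechanics.PeriodicConfiguration 3, ∀ R ε : ℝ, 0 < R → 0 < ε → ∀ x : (N : ℕ) → (Fin N → EuclideanSpace ℝ (Fin 3)), (∀ N, Literature.MathematicalPhysics.StatisticalMechanics.IsGroundState Literature.MathematicalPhysics.StatisticalMechanics.lennardJones (x N)) → Filter.Tendsto (fun N : ℕ => (Nat.card {i : Fin N // ¬ ∃ A : EuclideanSpace ℝ (Fin 3) →ₗᵢ[ℝ] EuclideanSpace ℝ (Fin 3), (∀ p ∈ P.points, ‖p‖ ≤ R → ∃ j : Fin N, dist (x N j) (x N i + A p) ≤ ε) ∧ (∀ j : Fin N, dist (x N j) (x N i) ≤ R → ∃ p ∈ P.points, dist (x N j) (x N i + A p) ≤ ε)} : ℝ) / N) Filter.atTop (nhds 0)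

/-- item stmt-AtomisticToContinuum-0752 · support · rank 9 · closed · proved by Summit.AtomisticToContinuum.Crystallization.Theorems.ThreeConeCertificateDefectVanishCrystallizes.defectVanishCrystallizes_proof (prover) · by planner
sources: BlancLewin2015, Xue1997
[support] SOFT ASSEMBLY LEMMA: BulkDefectVanish together with the uniform minimal distance of LJ
ground states (Literature fact LennardJonesMinimalDistance, Xue 1997 / BlancLewin2015 §2.2) implies
IsCrystallizing lennardJones 3: pick, for R_k = k, ε_k = 1/k, indices N_k ↑ and good particles i_k;
τ_k = −x_{i_k}; extract a convergent subsequence of the isometries A_k → A in O(3); minimal distance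
+ discreteness of P make the ε-matching a local bijection, so Σ_i f(x_i + τ_k) → Σ_{s ∈ A(P.points)}
f(s) for f ∈ C_c; A(P) is again a PeriodicConfiguration (rotate lattice and motif), multiplicity m ≡
1. -/
@[route_item "route-AtomisticToContinuum-HcpDefectCounting", crux]
def DefectVanishCrystallizes : Prop :=
  BulkDefectVanish → Literature.MathematicalPhysics.StatisticalMechanics.LennardJonesMinimalDistance → Literature.MathematicalPhysics.StatisticalMechanics.IsCrystallizing Literature.MathematicalPhysics.StatisticalMechanics.lennardJones 3

/-- `DefectVanishCrystallizes` holds: proved by `Summit.AtomisticToContinuum.Crystallization.Theorems.ThreeConeCertificateDefectVanishCrystallizes.defectVanishCrystallizes_proof`. -/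
theorem DefectVanishCrystallizes_holds : DefectVanishCrystallizes := _root_.Summit.AtomisticToContinuum.Crystallization.Theorems.ThreeConeCertificateDefectVanishCrystallizes.defectVanishCrystallizes_proof

/-- item stmt-AtomisticToContinuum-11865 · support · rank 9 · closed · proved by Summit.AtomisticToContinuum.Crystallization.Theorems.crysEnergyUpper_proof @ e4cec8285cc2 (prover) · by planner
sources: BlancLewin2015, Theil2006
[support] trial-state upper bound limsup E(N)/N ≤ ⨅ over periodic Q of e_LJ(Q) (shared item 0629,
same signature: finite blocks of Q plus far-away extras, boundary O(N^{2/3}), r⁻⁶ tail summable in d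
= 3; le_ciInf needs only Nonempty; coboundedness of the limsup from BlancLewin2015_8_holds /
lennardJones_stable_holds, both proved in tree). [difficulty: provable-now] -/
@[route_item "route-AtomisticToContinuum-HcpDefectCounting", crux]
def CrysEnergyUpper : Prop :=
  Filter.limsup (fun N : ℕ => Literature.MathematicalPhysics.StatisticalMechanics.groundStateEnergy Literature.MathematicalPhysics.StatisticalMechanics.lennardJones 3 N / N) Filter.atTop ≤ ⨅ Q : Literature.MathematicalPhysics.StatisticalMechanics.PeriodicConfiguration 3, Q.energyPerParticle Literature.MathematicalPhysics.StatisticalMechanics.lennardJones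

/-- `CrysEnergyUpper` holds: proved by `Summit.AtomisticToContinuum.Crystallization.Theorems.crysEnergyUpper_proof` @ e4cec8285cc2. -/
theorem CrysEnergyUpper_holds : CrysEnergyUpper := _root_.Summit.AtomisticToContinuum.Crystallization.Theorems.crysEnergyUpper_proof

/-- item stmt-AtomisticToContinuum-3061 · support · rank 9 · open · by planner
sources: Stillinger2001, PartayOrtnerCsanyi2017, BeterminSamajTravenec2022, BlancLewin2015
[target] X_E: some relaxed HCP stacking with parameters (a,h) in the box B is a least element of the
Lennard-Jones energy per particle over all periodic configurations of ℝ³ (names the minimiser that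
0627 leaves anonymous). -/
@[route_item "route-AtomisticToContinuum-HcpDefectCounting", crux]
def HcpPeriodicMinimiser : Prop :=
  ∃ a h : ℝ, ∃ (ha : a ≠ 0) (hh : h ≠ 0), 47 / 50 ≤ a ∧ a ≤ 1 ∧ 39 / 50 * a ≤ h ∧ h ≤ 17 / 20 * a ∧ IsLeast (Set.range fun Q : Literature.MathematicalPhysics.StatisticalMechanics.PeriodicConfiguration 3 => Q.energyPerParticle Literature.MathematicalPhysics.StatisticalMechanics.lennardJones) ((Literature.MathematicalPhysics.StatisticalMechanics.hcpPeriodicConfiguration ha hh).energyPerParticle Literature.MathematicalPhysics.StatisticalMechanics.lennardJones)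

/-- item stmt-AtomisticToContinuum-14479 · support · rank 10 · open · by planner
sources: BlancLewin2015
[support] (glue, energetic half) HcpBulkFloor → CrysEnergyUpper → CrysPeriodicBddBelow →
HcpPeriodicMinimiser ∧ CrysEnergyLimit. Proof: the floor gives N·e ≤ E(N) (le_ciInf over injective
configurations, nonempty_injective_config) hence e ≤ E(N)/N for N ≥ 1; with limsup E(N)/N ≤ ⨅_Q e(Q)
≤ e(hcp a h) (ciInf_le, 0714) the bounded sequence E(N)/N (−B ≤ · ≤ 0) converges to e = ⨅, and e ≤
liminf ≤ ⨅ ≤ e(Q) for all Q gives IsLeast with the same (a,h) and box. [difficulty: provable-now] -/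
@[route_item "route-AtomisticToContinuum-HcpDefectCounting", crux]
def FloorGivesMinimiser : Prop :=
  HcpBulkFloor → CrysEnergyUpper → CrysPeriodicBddBelow → HcpPeriodicMinimiser ∧ CrysEnergyLimit

/-- item stmt-AtomisticToContinuum-14480 · support · rank 10 · open · by planner
sources: BlancLewin2015
[support] (glue, converse; lets a proof of 3061 ∧ 0626 elsewhere close HcpBulkFloor)
HcpPeriodicMinimiser → CrysEnergyLimit → HcpBulkFloor. Proof: IsLeast.csInf_eq turns 0626 into
E(N)/N → e(hcp a h); LJ superadditivity E(kN) ≤ k·𝓔(x) for every injective x of N ≥ 1 points (k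
translates of x pairwise ≥ diam + 1 apart: cross distances ≥ 1 so cross terms ≤ 0 by
lennardJones_nonpos; interactionEnergy_append) gives E(kN)/(kN) ≤ 𝓔(x)/N, and k → ∞ along the
subsequence kN gives e ≤ 𝓔(x)/N; N = 0 is 0 ≤ 0. [difficulty: provable-now] -/
@[route_item "route-AtomisticToContinuum-HcpDefectCounting"]
def MinimiserGivesFloor : Prop :=
  HcpPeriodicMinimiser → CrysEnergyLimit → HcpBulkFloor

/-- item stmt-AtomisticToContinuum-14481 · support · rank 10 · open · by planner
sources: BlancLewin2015, Theil2006
[support] (glue, positional half; Chebyshev counting) HcpDefectCoercivity → HcpBulkFloor →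
HcpChartGluing → CrysEnergyUpper → CrysPeriodicBddBelow → BulkDefectVanish. Proof: take (a,h, floor)
from HcpBulkFloor and P := hcpPeriodicConfiguration ha hh; fix R, ε and a sequence of ground states
x^N; δ from the PROVED LennardJonesMinimalDistance_holds; (θ, M) from HcpChartGluing; κ from
HcpDefectCoercivity(δ, θ). Then #Bad(R,ε) ≤ M·#Bad(4,θ) ≤ (M/κ)(E(N) − N·e) since 𝓔(x^N) = E(N), and
0 ≤ E(N)/N − e → 0 (floor below; limsup ≤ ⨅ ≤ e above), so #Bad(R,ε)/N → 0 — literally the predicate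
of stmt-0751. [difficulty: provable-now] -/
@[route_item "route-AtomisticToContinuum-HcpDefectCounting", crux]
def DefectGlue : Prop :=
  HcpDefectCoercivity → HcpBulkFloor → HcpChartGluing → CrysEnergyUpper → CrysPeriodicBddBelow → BulkDefectVanish

/-- item stmt-AtomisticToContinuum-14482 · assembly · rank 1 · open · by planner
sources: BlancLewin2015
[assembly] HcpDefectCoercivity → HcpBulkFloor → HcpChartGluing → CrysEnergyUpper →
CrysPeriodicBddBelow → FloorGivesMinimiser → DefectGlue → DefectVanishCrystallizes → Crystallization
(the sub-problem Statement decl `_root_.Crystallization`). -/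
@[route_item "route-AtomisticToContinuum-HcpDefectCounting"]
def Assembly : Prop :=
  HcpDefectCoercivity → HcpBulkFloor → HcpChartGluing → CrysEnergyUpper → CrysPeriodicBddBelow → FloorGivesMinimiser → DefectGlue → DefectVanishCrystallizes → _root_.Crystallization

/-! D-0027 §2.1 — DECIDING THEOREM (planner-authored via `route open/edit --closes-file`; by planner-plancard-AtomisticToContinuum-Crystal-f8ad38a7-g2-0 2026-08-15T19:08:50Z):
its hypotheses are this route's items and its conclusion the sub-problem Statement (glue_lint), and it elaborates with this file. -/

@[closes "route-AtomisticToContinuum-HcpDefectCounting"] theorem closes (hC : HcpDefectCoercivity) (hE : HcpBulkFloor) (hG : HcpChartGluing)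
    (hU : CrysEnergyUpper) (hB : CrysPeriodicBddBelow) (hFM : FloorGivesMinimiser)
    (hDG : DefectGlue) (hV : DefectVanishCrystallizes) : _root_.Crystallization := by
  obtain ⟨⟨a, h, ha, hh, -, -, -, -, hleast⟩, hlim⟩ := hFM hE hU hB
  refine ⟨⟨_, hleast, ?_⟩, hV (hDG hC hE hG hU hB)
    Literature.MathematicalPhysics.StatisticalMechanics.LennardJonesMinimalDistance_holds⟩
  have e : (⨅ Q : Literature.MathematicalPhysics.StatisticalMechanics.PeriodicConfiguration 3,
      Q.energyPerParticle Literature.MathematicalPhysics.StatisticalMechanics.lennardJones) = _ :=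
    hleast.csInf_eq
  dsimp only [CrysEnergyLimit] at hlim
  rw [e] at hlim
  exact hlim

end Summit.AtomisticToContinuum.Crystallization.Theses.HcpDefectCounting
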